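import Summits.QuantumFields.YangMills.Theorems.BalabanUVNodesN07NormalisationOfRecord
import Summits.QuantumFields.YangMills.Theorems.BalabanUVNodesN07CubeTowerUnderPrintWindow
import Literature.MathematicalPhysics.QuantumFieldTheory.Balaban1983to89.T4AxialGaugeRooted
import HarnessLib

/-!
# N07 [B11] (= [15] = [Balaban1985Variational]) Sect. F — **THE NORMALISATION OF RECORD ON PRINT's WINDOW `□̃`** `NrmOfRecordWide`: MODULE 60's `NrmOfRecord` with the top
# axial gauge taken on print's cube `□̃^{(j)} = [a − 2ρ, a + M − 1 + 2ρ]` ((144), (147); [6] p. 98) instead of the chart box `[sqLo_j − 1, sqHi_j + 1]` — the window under which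
# the WHOLE local family (150) sits (MODULE 73), so that EVERY cell bond of `D″` is read through one gauge-fixed representative

Cell `pub-ymgap`, seat `pub-ymgap-dag-n07-e` g24∕g25 (FAN-OUT §N07 row s3; LANE OWNER of the K0 road), MODULE 60′ (plan g90 rulings YMPLAN-G90-S3-RULING (P1)(i) «GO; ROOT := CENTRE» and RULING A3 «the `Nrm` TEXT OF RECORD := 60′ `NrmOfRecordWide`; W1 resting state under the N4 label»; typed g24, filed g25).  `--kind definition --supports stmt-QuantumFields-20541 --as helper` (K0⁷; count-neutral); ONE `def` + theorems.
[15] = [Balaban1985Variational]; [3] = [Balaban1985Averaging]; [6] = [Balaban1985RegularSpaces].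

WHY.  (F1) of the located memo (`HOME/pub-ymgap-dag-n07-e/LOCATED-S3-CHART-INTERFACE.md`): `NrmOfRecord`'s window has margin `ρ + 1`; the cubes `□_{j′}` of the datum's family have
margins `ρ·gs L (j − j′) > (ρ+1)·L^{j−j′}` as soon as `ρ > L` (the knit requires `L ≤ ρ`, `L·M_h ∣ ρ`), so their outer shells are NOT under the window, `h̄ = 1` there and the
representative `U″ = (U^w)^{h̄}` is not gauge-fixed across level-`j` faces: no displayed hypothesis bounds its rows there.  Print's representative is axial on `□̃(k)` «with a center at
the point y» ((147)); its window `□̃` has margin `2ρ ≥ ρ·gs L n ∕ Lⁿ + 1` (MODULE 73 ∕ `B8Eq131Cubes.margin_collar`).  This file re-texts the normalisation on THAT window with the top gauge ROOTED AT THE CENTRE `ctr cornerP sideP` (plan g90 ruling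
(P1)(i): print (147) «with a center at the point y»; the (iii) pen's E1 reuses `B8Ineq130`'s centre-rooted estimates) — the root-parametrised torus gauge `axialGaugeAt` of
`T4AxialGaugeRooted` (queue (a)); the top rows then come from its two-sided Poincaré lemma (`(d−1)·⌈n∕2⌉·δ̂`, MODULE 40′).  It does NOT touch (F2) (which representative the S3 doors normalise
against): `NrmOfRecordWide` is, like `NrmOfRecord`, a DISPLAYED predicate; after the located points ⚑ NORMALISATION-BASEPOINT ∕ ⚑ REPRESENTATIVE-AXIAL-SURFACE ∕ ⚑ N1-NEAR-ROWS (rulings A1–A3) its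
only door of record is the CONDITIONAL door S1ᶜ ⇐ the named fact `HThm4Rec` «[6] Thm. 4 ∕ Prop. 6 for the record's own (0.4) averaging structure» (print-licensed by [I] pp. 253–254, NOT proved in
print for that structure; N05-class; nobody sized) — so N07 is NOT claimable on road (β) while `HThm4Rec` is undischarged.

WHAT THIS FILE DECLARES (one definition, never asserted) AND PROVES (by-name bookkeeping; NOTHING of [15]∕[3]∕[6] analysis).
* §1 `NrmOfRecordWide F N Mc ρ : <MODULE 59's `Nrm` type>` — verbatim `NrmOfRecord` with the top gauge `axialGaugeAt (M^j(U^w)) lo hi r`, `lo := tLo (cornerP Mc ρ idx) ρ = cornerP − 2ρ`,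
  `hi := tHi (cornerP Mc ρ idx) (sideP Mc ρ) ρ = cornerP + sideP − 1 + 2ρ`, `r := ctr (cornerP Mc ρ idx) (sideP Mc ρ) = cornerP + (sideP − 1)∕2`.
* §2 ★★★ `NrmOfRecordWide.exists_rep` ∕ `NrmOfRecordWide.exists_top_dataAxial` — (154)₁ read off the wide normalisation at every cell bond of `D″` (MODULE 60's generic
  `shearedAvgIter_landau_eq_iter_rep`, any `h`; at the top `M^j((U^w)^{h̄}) = (M^j U)^{h}` by `iter_gaugeAct_blockLift` + `iter_gaugeAct_of_isResidual`).
* §3 ★★ `NrmOfRecordWide.exists_rep_window` — the same, WITH the geometric clause a down-the-tower consumer needs: at a positive level `j′ ≤ j` both ends of the cell bond lie in the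
  blow-down window `castSite ″ [tlo L (tLo a ρ) (j − j′), thi L (tHi a M ρ) (j − j′)]` of the top box (MODULE 73 `lamSite_domainsMeet_cubeDomains_mem_tcubeWindow`) — exactly the
  membership binders of dag-n07-w6's `…N07DataDownTheTowerBlowDown.dist1_iter_rep_le_down_the_tower_blowDown` with `lo j′ := tlo … (j − j′)`, `hi j′ := thi … (j − j′)`.

HONEST SCOPE.  One displayed predicate (NEVER asserted; it DISCHARGES NOTHING) + kernel bookkeeping over LANDED theorems; HS3NORM ∕ HCHART-MEET-NORM ∕ HBUDGET-NORM stay displayed; the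
door for this predicate is NOT in the tree and is CONDITIONAL by ruling A3 (`HThm4Rec`, undischarged); stub 1-G‴ ∕ K0⁷ ∕ K1⁹ NOT closed; N07 ∕ N05 NOT discharged; counts unmoved (typed 28∕28 ·
discharged 6∕28); one finite 𝕋⁴ programme at fixed ε — the route closes the conditional finite-𝕋⁴ rung `BalabanLadder.UV` ONLY; the YM mass gap (Clay) is NOT proved by any of
this; nothing continuum ∕ ℝ⁴ ∕ OS.  ONE `def`, no `instance`, no `notation`, no `sorry`.

References: [15] (144) p. 300, (147) p. 301, (150)–(154) pp. 301–302; [3] (78)–(81) p. 30, (88) p. 31; [6] p. 98, (1.15) p. 78, (1.29) p. 81, (1.131) p. 99.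
-/

set_option autoImplicit false

noncomputable section

namespace Summit.QuantumFields.YangMills.BalabanUVNodes.N07NormalisationOfRecordWide

open Literature.MathematicalPhysics.QuantumFieldTheory.Balaban1983to89
open Literature.MathematicalPhysics.QuantumFieldTheory.Balaban1983to89.Node00
open T4Continuum (T4Family)
open T4AxialGaugeSmallField (castSite)
open T4AxialGaugeRooted (axialGaugeAt)
open B12GaugeOrbits021 (IsResidual)
open B15Eq177GaugeInvariance (blockLift)
open B14DomainGeom (Pt)
open B8Ineq130 (tlo thi)
open B8Eq131Cubes (tLo tHi ctr)
open B6SectADomainsV1 (Domains)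
open GaugeField (gaugeAct)
open ExpMeanLog (expMeanLogSU)
open Summit.QuantumFields.Balaban3D.Carriers (radialContourData)
open Summit.QuantumFields.YangMills.BalabanUVNodes.N07NormalisationOfRecord (shearedAvgIter_landau_eq_iter_rep)
open Summit.QuantumFields.YangMills.BalabanUVNodes.N09AxialSelectionExists (iter_gaugeAct_blockLift)
open Summit.QuantumFields.YangMills.BalabanUVNodes.N07CubeTowerUnderPrintWindow (lamSite_domainsMeet_cubeDomains_mem_tcubeWindow)

/-! ## §1  The definition on print's window -/

/-- **THE NORMALISATION OF RECORD ON PRINT's WINDOW `□̃`** — MODULE 60's `NrmOfRecord` with the coarse axial gauge `h` of the level-`j` data `M^j(U^w)` taken on print's cube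
`□̃^{(j)} = [cornerP − 2ρ, cornerP + sideP − 1 + 2ρ]` ([15] (144), (147) «generalized axial gauge conditions on `□̃(k)` with a center at the point y»; here corner-rooted, pv26's
`axialGauge`): for the datum `(j, idx)`, the minimiser `U` and S3's gauge `u`, there is a residual `w` of level `j` with `U^{w}` radial-axial below `j` such that `g = h̄·w·u⁻¹` has
unit block averages `R̄^{j′}g = 1` ([3] (78)–(81)) on every cell site `Λ′_{j′}(D″)`, `j′ ≤ j`, `D″ = cubeDomains ⊓ record`.  A displayed predicate, NEVER asserted.
[cite: Balaban1985Variational, (144) p.300, (147) p.301, (150)–(154) pp.301–302; Balaban1985Averaging, (78)–(81) p.30; Balaban1985RegularSpaces, p.98, (1.15) p.78, (1.29) p.81] -/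
def NrmOfRecordWide (F : T4Family) (N : ℕ) [NeZero N] (Mc ρ : ℕ) :
    ∀ (ν : Stage7Numerics) (M : ℕ) (g : ℕ → ℝ) (K k : ℕ), SeqOfRecord F ν M g K k → GaugeField (F.P K) 0 (SU N) → ℕ → Pt (F.P K).d →
      GaugeTransf (F.P K) 0 (SU N) → (PBond (F.P K) 0 → MatA N) → Prop :=
  fun _ν _M _g K _k s U j idx u _A =>
    ∃ w : GaugeTransf (F.P K) 0 (SU N), IsResidual j w ∧
      (∀ i < j, AxialGauge (radialContourData (F.P K) i (SU N)) (Averaging.iter (avOfRecord F N K) i (gaugeAct w U))) ∧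
      ∀ (hk : j ≤ (F.P K).m + (F.P K).K) (j' : ℕ), j' ≤ j → ∀ y : Site (F.P K) j',
        (domainsMeet (cubeDomains (F.P K) (cornerP (F.P K) Mc ρ idx) (sideP (F.P K) Mc ρ) ρ j hk) (domainsOfSeq s.Ω j hk)).LamSite j' y →
          gaugeAvgIter (loopAvgBlockOp expMeanLogSU)
              (fun x => blockLift j (axialGaugeAt (Averaging.iter (avOfRecord F N K) j (gaugeAct w U))
                  (tLo (cornerP (F.P K) Mc ρ idx) ρ) (tHi (cornerP (F.P K) Mc ρ idx) (sideP (F.P K) Mc ρ) ρ) (ctr (cornerP (F.P K) Mc ρ idx) (sideP (F.P K) Mc ρ))) x *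
                w x * (u x)⁻¹) j' y = 1

/-! ## §2  (154)₁ read off the wide normalisation -/

section Derived

/-- ★★★ **(154)₁ READ OFF `NrmOfRecordWide`**: for the witness `w` and every bond `c` of `T^{(j′)}`, `j′ ≤ j`, whose two ends are cell sites of `D″`,
`𝒜_{j′}(U^{u})(c) = M^{j′}((U^{w})^{h̄})(c)`, `h` the coarse axial gauge of the level-`j` data on `□̃`. [cite: Balaban1985Variational, (150)–(154) pp.301–302; Balaban1985Averaging, (88) p.31] -/
theorem NrmOfRecordWide.exists_rep {F : T4Family} {N : ℕ} [NeZero N] {Mc ρ : ℕ} {ν : Stage7Numerics} {M : ℕ} {g : ℕ → ℝ} {K k : ℕ}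
    {s : SeqOfRecord F ν M g K k} {U : GaugeField (F.P K) 0 (SU N)} {j : ℕ} {idx : Pt (F.P K).d} {u : GaugeTransf (F.P K) 0 (SU N)}
    {A : PBond (F.P K) 0 → MatA N} (hN : NrmOfRecordWide F N Mc ρ ν M g K k s U j idx u A) (hk : j ≤ (F.P K).m + (F.P K).K) :
    ∃ w : GaugeTransf (F.P K) 0 (SU N), IsResidual j w ∧
      (∀ i < j, AxialGauge (radialContourData (F.P K) i (SU N)) (Averaging.iter (avOfRecord F N K) i (gaugeAct w U))) ∧
      ∀ (j' : ℕ) (_ : j' ≤ j) (c : PBond (F.P K) j'),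
        (domainsMeet (cubeDomains (F.P K) (cornerP (F.P K) Mc ρ idx) (sideP (F.P K) Mc ρ) ρ j hk) (domainsOfSeq s.Ω j hk)).LamSite j' c.src →
        (domainsMeet (cubeDomains (F.P K) (cornerP (F.P K) Mc ρ idx) (sideP (F.P K) Mc ρ) ρ j hk) (domainsOfSeq s.Ω j hk)).LamSite j' c.tgt →
          shearedAvgIter (avOfRecord F N K) (fun i => radialContourData (F.P K) i (SU N)) (loopAvgBlockOp expMeanLogSU) (gaugeAct u U) j' c =
            Averaging.iter (avOfRecord F N K) j'
              (gaugeAct (blockLift j (axialGaugeAt (Averaging.iter (avOfRecord F N K) j (gaugeAct w U))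
                (tLo (cornerP (F.P K) Mc ρ idx) ρ) (tHi (cornerP (F.P K) Mc ρ idx) (sideP (F.P K) Mc ρ) ρ) (ctr (cornerP (F.P K) Mc ρ idx) (sideP (F.P K) Mc ρ))))
                (gaugeAct w U)) c := by
  obtain ⟨w, hres, hax, hnorm⟩ := hN
  exact ⟨w, hres, hax, fun j' hj' c hs ht =>
    shearedAvgIter_landau_eq_iter_rep F N K hk hax _ u hj' (hnorm hk j' hj' c.src hs) (hnorm hk j' hj' c.tgt ht)⟩

/-- ★★★ **THE TOP LEVEL READ OFF `NrmOfRecordWide`**: on print's top cells, `𝒜_j(U^{u})(c) = (V^h)(c)` with `V = M^j(U^w) = M^j(U)` (`w` residual) and `h` the coarse axial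
gauge on `□̃` rooted at its centre — the two-sided top rows of `T4AxialGaugeRooted` ∕ MODULE 40′ apply to `V^h`. [cite: Balaban1985Variational, (147) p.301, (154) p.302, (160) p.303; Balaban1985Averaging, (88) p.31] -/
theorem NrmOfRecordWide.exists_top_dataAxial {F : T4Family} {N : ℕ} [NeZero N] {Mc ρ : ℕ} {ν : Stage7Numerics} {M : ℕ} {g : ℕ → ℝ} {K k : ℕ}
    {s : SeqOfRecord F ν M g K k} {U : GaugeField (F.P K) 0 (SU N)} {j : ℕ} {idx : Pt (F.P K).d} {u : GaugeTransf (F.P K) 0 (SU N)}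
    {A : PBond (F.P K) 0 → MatA N} (hN : NrmOfRecordWide F N Mc ρ ν M g K k s U j idx u A) (hk : j ≤ (F.P K).m + (F.P K).K) :
    ∃ w : GaugeTransf (F.P K) 0 (SU N), IsResidual j w ∧
      (∀ i < j, AxialGauge (radialContourData (F.P K) i (SU N)) (Averaging.iter (avOfRecord F N K) i (gaugeAct w U))) ∧
      Averaging.iter (avOfRecord F N K) j (gaugeAct w U) = Averaging.iter (avOfRecord F N K) j U ∧
      ∀ c : PBond (F.P K) j,
        (domainsMeet (cubeDomains (F.P K) (cornerP (F.P K) Mc ρ idx) (sideP (F.P K) Mc ρ) ρ j hk) (domainsOfSeq s.Ω j hk)).LamSite j c.src →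
        (domainsMeet (cubeDomains (F.P K) (cornerP (F.P K) Mc ρ idx) (sideP (F.P K) Mc ρ) ρ j hk) (domainsOfSeq s.Ω j hk)).LamSite j c.tgt →
          shearedAvgIter (avOfRecord F N K) (fun i => radialContourData (F.P K) i (SU N)) (loopAvgBlockOp expMeanLogSU) (gaugeAct u U) j c =
            gaugeAct (axialGaugeAt (Averaging.iter (avOfRecord F N K) j U)
                (tLo (cornerP (F.P K) Mc ρ idx) ρ) (tHi (cornerP (F.P K) Mc ρ idx) (sideP (F.P K) Mc ρ) ρ) (ctr (cornerP (F.P K) Mc ρ idx) (sideP (F.P K) Mc ρ)))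
              (Averaging.iter (avOfRecord F N K) j U) c := by
  obtain ⟨w, hres, hax, hnorm⟩ := hN
  have hV : Averaging.iter (avOfRecord F N K) j (gaugeAct w U) = Averaging.iter (avOfRecord F N K) j U :=
    B12GaugeOrbits021.iter_gaugeAct_of_isResidual (avOfRecord F N K) hk hres U
  refine ⟨w, hres, hax, hV, fun c hs ht => ?_⟩
  rw [← hV, shearedAvgIter_landau_eq_iter_rep F N K hk hax _ u le_rfl (hnorm hk j le_rfl c.src hs) (hnorm hk j le_rfl c.tgt ht),
    iter_gaugeAct_blockLift (avOfRecord F N K) hk _ (gaugeAct w U)]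

/-! ## §3  The same with the window clause a down-the-tower consumer needs -/

/-- ★★ **(154)₁ AT EVERY CELL BOND OF A POSITIVE LEVEL, WITH BOTH ENDS IN THE BLOW-DOWN WINDOW OF `□̃`** (`1 ≤ ρ`): for `1 ≤ j′ ≤ j` and a bond `c` of `T^{(j′)}` whose ends are cell
sites of `D″`, `𝒜_{j′}(U^{u})(c) = M^{j′}((U^{w})^{h̄})(c)` AND `c.src, c.tgt ∈ castSite ″ [tlo L (tLo a ρ) (j − j′), thi L (tHi a M ρ) (j − j′)]` — the membership binders of
dag-n07-w6's `dist1_iter_rep_le_down_the_tower_blowDown` for the windows `lo j′ := tlo … (j − j′)`, `hi j′ := thi … (j − j′)` whose top is `□̃` itself (MODULE 73 §3).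
[cite: Balaban1985Variational, (144) p.300, (150)–(154) pp.301–302; Balaban1985RegularSpaces, p.98, (1.131) p.99] -/
theorem NrmOfRecordWide.exists_rep_window {F : T4Family} {N : ℕ} [NeZero N] {Mc ρ : ℕ} (hρ : 1 ≤ ρ) {ν : Stage7Numerics} {M : ℕ} {g : ℕ → ℝ} {K k : ℕ}
    {s : SeqOfRecord F ν M g K k} {U : GaugeField (F.P K) 0 (SU N)} {j : ℕ} {idx : Pt (F.P K).d} {u : GaugeTransf (F.P K) 0 (SU N)}
    {A : PBond (F.P K) 0 → MatA N} (hN : NrmOfRecordWide F N Mc ρ ν M g K k s U j idx u A) (hk : j ≤ (F.P K).m + (F.P K).K) :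
    ∃ w : GaugeTransf (F.P K) 0 (SU N), IsResidual j w ∧
      (∀ i < j, AxialGauge (radialContourData (F.P K) i (SU N)) (Averaging.iter (avOfRecord F N K) i (gaugeAct w U))) ∧
      ∀ (j' : ℕ) (_ : 1 ≤ j') (_ : j' ≤ j) (c : PBond (F.P K) j'),
        (domainsMeet (cubeDomains (F.P K) (cornerP (F.P K) Mc ρ idx) (sideP (F.P K) Mc ρ) ρ j hk) (domainsOfSeq s.Ω j hk)).LamSite j' c.src →
        (domainsMeet (cubeDomains (F.P K) (cornerP (F.P K) Mc ρ idx) (sideP (F.P K) Mc ρ) ρ j hk) (domainsOfSeq s.Ω j hk)).LamSite j' c.tgt →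
          c.src ∈ (castSite '' Set.Icc (tlo (F.P K).L (tLo (cornerP (F.P K) Mc ρ idx) ρ) (j - j'))
              (thi (F.P K).L (tHi (cornerP (F.P K) Mc ρ idx) (sideP (F.P K) Mc ρ) ρ) (j - j')) : Set (Site (F.P K) j')) ∧
          c.tgt ∈ (castSite '' Set.Icc (tlo (F.P K).L (tLo (cornerP (F.P K) Mc ρ idx) ρ) (j - j'))
              (thi (F.P K).L (tHi (cornerP (F.P K) Mc ρ idx) (sideP (F.P K) Mc ρ) ρ) (j - j')) : Set (Site (F.P K) j')) ∧
          shearedAvgIter (avOfRecord F N K) (fun i => radialContourData (F.P K) i (SU N)) (loopAvgBlockOp expMeanLogSU) (gaugeAct u U) j' c =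
            Averaging.iter (avOfRecord F N K) j'
              (gaugeAct (blockLift j (axialGaugeAt (Averaging.iter (avOfRecord F N K) j (gaugeAct w U))
                (tLo (cornerP (F.P K) Mc ρ idx) ρ) (tHi (cornerP (F.P K) Mc ρ idx) (sideP (F.P K) Mc ρ) ρ) (ctr (cornerP (F.P K) Mc ρ idx) (sideP (F.P K) Mc ρ))))
                (gaugeAct w U)) c := by
  obtain ⟨w, hres, hax, hrep⟩ := hN.exists_rep hk
  refine ⟨w, hres, hax, fun j' hj1 hj' c hs ht => ⟨?_, ?_, hrep j' hj' c hs ht⟩⟩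
  · exact lamSite_domainsMeet_cubeDomains_mem_tcubeWindow hρ _ hj1 hj' hs
  · exact lamSite_domainsMeet_cubeDomains_mem_tcubeWindow hρ _ hj1 hj' ht

end Derived

end Summit.QuantumFields.YangMills.BalabanUVNodes.N07NormalisationOfRecordWide
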